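import Literature.ComputerArithmetic.Shewchuk1997.FastExpansionSum
import Literature.ComputerArithmetic.GraillatMuller2025.CRDWPlusFP
import Mathlib.Tactic.Linarith
import Mathlib.Tactic.Positivity
import Mathlib.Tactic.Ring
import Mathlib.Tactic.NormNum

/-!
# Shewchuk (1997), §2.3: TWO-DIFF; §2.8: the sign test and the zero test for expansions

J. R. Shewchuk, *Adaptive precision floating-point arithmetic and fast robust geometric
predicates*, Discrete Comput. Geom. 18 (1997) 305–363 [Shewchuk1997].  Two small pieces of the
expansion toolkit that the geometric predicates of §4 rely on and that the earlier files of this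
directory (`ExpansionArithmetic.lean` §2.1–2.4, `FastExpansionSum.lean` §2.4, `ScaleExpansion.lean`
§2.5–2.6, `Compress.lean` §2.7) do not contain.  As printed:

> (§2.3, p. 315, following the proof of Theorem 7.) Two-term subtraction ("TWO-DIFF") is
> implemented by the sequence `x ⇐ a ⊖ b`; `b_virtual ⇐ a ⊖ x`; `a_virtual ⇐ x ⊕ b_virtual`;
> `b_roundoff ⇐ b_virtual ⊖ b`; `a_roundoff ⇐ a ⊖ a_virtual`; `y ⇐ a_roundoff ⊕ b_roundoff`.

> (§2.8, p. 334.) The easiest way to compare two expansions is to subtract one from the other,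
> and test the sign of the result. An expansion's sign can be easily tested because of the
> nonoverlapping property; simply check the sign of the expansion's most significant nonzero
> component. (If zero elimination is employed, check the component with the largest index.) A
> nonoverlapping expansion is equal to zero if and only if all its components are equal to zero.

MODEL / DICTIONARY (as in `ExpansionArithmetic.lean`).  Floats are `JeannerodRump2018.IsFloat p emin`
over `ℚ` (precision `p`, gradual underflow, no overflow); `fl` is ANY round-to-nearest map
`IsRoundNearest p emin fl`, "round-to-even" is `roundTiesEven p emin`; `⊕, ⊖` are `fl (· + ·)`,
`fl (· − ·)`.  Expansions are `List ℚ` listed from the SMALLEST component; "nonoverlapping and in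
increasing order except for zeros" is `IsExpansion 1` (= pairwise `Below 1`), see
`isExpansion_one_iff`.

WHAT IS PROVED, AND ITS SCOPE.
* `twoDiff` is TWO-DIFF verbatim.  `twoDiff_eq_twoSum_neg`: for a rounding that commutes with
  negation, `fl (−t) = −fl t`, TWO-DIFF(a, b) coincides LINE BY LINE with TWO-SUM(a, −b) (the tree's
  `twoSum`, Theorem 7); hence `x = a ⊖ b` and `y = (a − b) − x` exactly, `x + y = a − b`
  (`twoDiff_exact`), and `y` lies nonoverlapping — with round-to-even, nonadjacent — below `x`
  (`twoDiff_below`, `twoDiff_nonoverlapping`, `twoDiff_nonadjacent`: the TWO-DIFF cases of Theorem 7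
  and Corollary 9).  The symmetry hypothesis holds for every round-to-nearest whose tie rule is
  sign-symmetric, in particular for IEEE 754 round-to-nearest-even (`roundTiesEven_neg`
  [GraillatMuller2025]), the paper's standing assumption; a round-to-nearest with a tie rule that is
  NOT sign-symmetric is not covered by this reduction (the paper's claim for "any exactly rounded
  arithmetic" would need the Theorem 7 argument redone for `⊖`, which this file does not do).
* §2.8: `abs_sum_lt_abs_of_isExpansion` — in a nonoverlapping increasing expansion of floats, the
  components below a nonzero component `t` sum to less than `|t|` in magnitude (with `t = M·2^v`,
  `M` odd, each of them is `< 2^v`, and so is their nonoverlapping sum); consequently the sum has the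
  sign of the most significant nonzero component (`sum_pos_iff_of_isExpansion`, and, for a list whose
  LAST component is nonzero — the zero-eliminated case — `sign_sum_of_getLast_ne_zero`), and
  `sum_eq_zero_iff_of_isExpansion`: the sum is zero iff all components are zero.
-/

namespace Literature.ComputerArithmetic.Shewchuk1997

open Literature.ComputerArithmetic.JeannerodRump2018
open Literature.ComputerArithmetic.BoldoJeannerodMelquiondMuller2023 hiding twoSum
open Literature.ComputerArithmetic.GraillatMuller2025 (roundTiesEven_neg)

variable {p : ℕ} {emin : ℤ} {fl : ℚ → ℚ}

/-! ## §2.3: TWO-DIFF -/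

/-- **TWO-DIFF(a, b)**, verbatim: `x ⇐ a ⊖ b`; `b_virtual ⇐ a ⊖ x`; `a_virtual ⇐ x ⊕ b_virtual`;
`b_roundoff ⇐ b_virtual ⊖ b`; `a_roundoff ⇐ a ⊖ a_virtual`; `y ⇐ a_roundoff ⊕ b_roundoff`;
`return (x, y)`. [cite: Shewchuk1997, §2.3 p. 315] -/
def twoDiff (fl : ℚ → ℚ) (a b : ℚ) : ℚ × ℚ :=
  let x := fl (a - b)
  let bvirtual := fl (a - x)
  let avirtual := fl (x + bvirtual)
  let broundoff := fl (bvirtual - b)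
  let aroundoff := fl (a - avirtual)
  (x, fl (aroundoff + broundoff))

/-- Line 1 of TWO-DIFF: `x = a ⊖ b`. [cite: Shewchuk1997, §2.3 p. 315] -/
theorem twoDiff_fst (fl : ℚ → ℚ) (a b : ℚ) : (twoDiff fl a b).1 = fl (a - b) := rfl

/-- For a rounding that commutes with negation (`fl (−t) = −fl t`: any sign-symmetric tie rule, e.g.
round-to-even), TWO-DIFF(a, b) is TWO-SUM(a, −b) line by line: `a ⊖ x = −(x ⊖ a)`, so
`b_virtual` changes sign and the remaining lines agree. [cite: Shewchuk1997, §2.3 p. 315] -/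
theorem twoDiff_eq_twoSum_neg (hodd : ∀ t, fl (-t) = -fl t) (a b : ℚ) :
    twoDiff fl a b = twoSum fl a (-b) := by
  show (fl (a - b), fl (fl (a - fl (fl (a - b) + fl (a - fl (a - b)))) +
      fl (fl (a - fl (a - b)) - b))) =
    (fl (a + -b), fl (fl (a - fl (fl (a + -b) - fl (fl (a + -b) - a))) +
      fl (-b - fl (fl (a + -b) - a))))
  have hab : a + -b = a - b := (sub_eq_add_neg a b).symm
  have hbv : fl (fl (a - b) - a) = -fl (a - fl (a - b)) := by rw [← hodd, neg_sub]
  rw [hab, hbv, sub_neg_eq_add, sub_neg_eq_add, neg_add_eq_sub]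

/-- **TWO-DIFF IS EXACT** (the subtraction case of Theorem 7), for a rounding commuting with
negation: `x = a ⊖ b`, `y = (a − b) − x = −err(a ⊖ b)`, `x + y = a − b`, for ALL floats `a`, `b`
(`p ≥ 1`, gradual underflow). [cite: Shewchuk1997, Thm 7 p. 314–315; §2.3 p. 315] -/
theorem twoDiff_exact (hp : 1 ≤ p) (hfl : IsRoundNearest p emin fl) (hodd : ∀ t, fl (-t) = -fl t)
    {a b : ℚ} (ha : IsFloat p emin a) (hb : IsFloat p emin b) :
    (twoDiff fl a b).1 = fl (a - b) ∧ (twoDiff fl a b).2 = a - b - fl (a - b) ∧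
      (twoDiff fl a b).1 + (twoDiff fl a b).2 = a - b := by
  have h := twoSum_exact hp hfl ha hb.neg
  rw [← twoDiff_eq_twoSum_neg hodd, ← sub_eq_add_neg] at h
  exact ⟨rfl, h⟩

/-- Both outputs of TWO-DIFF are floats (each is the result of a rounded operation).
[cite: Shewchuk1997, §2.3 p. 315] -/
theorem isFloat_twoDiff (hfl : IsRoundNearest p emin fl) (a b : ℚ) :
    IsFloat p emin (twoDiff fl a b).1 ∧ IsFloat p emin (twoDiff fl a b).2 :=
  ⟨(hfl _).1, (hfl _).1⟩

/-- TWO-DIFF, oriented form used by the expansion algorithms: `y` lies `c`-below `x` whenever the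
rounding has `RoundoffBelow c` (`c = 1`: nonoverlapping, any round-to-nearest; `c = 2`: nonadjacent,
round-to-even). [cite: Shewchuk1997, Thm 7 p. 314; Cor 9 p. 315] -/
theorem twoDiff_below (hp : 1 ≤ p) (hfl : IsRoundNearest p emin fl) (hodd : ∀ t, fl (-t) = -fl t)
    {c : ℚ} (hflc : RoundoffBelow c fl) {a b : ℚ} (ha : IsFloat p emin a) (hb : IsFloat p emin b) :
    Below c (twoDiff fl a b).2 (twoDiff fl a b).1 := by
  rw [twoDiff_eq_twoSum_neg hodd]; exact twoSum_below hp hfl hflc ha hb.neg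

/-- **THEOREM 7 for TWO-DIFF**: `x` and `y` are nonoverlapping. [cite: Shewchuk1997, Thm 7 p. 314] -/
theorem twoDiff_nonoverlapping (hp : 1 ≤ p) (hfl : IsRoundNearest p emin fl)
    (hodd : ∀ t, fl (-t) = -fl t) {a b : ℚ} (ha : IsFloat p emin a) (hb : IsFloat p emin b) :
    Nonoverlapping (twoDiff fl a b).1 (twoDiff fl a b).2 :=
  nonoverlapping_comm.mp (twoDiff_below hp hfl hodd (roundoffBelow_one hp hfl) ha hb).nonoverlapping

/-- **COROLLARY 9 for TWO-DIFF**: with round-to-even tiebreaking, `x` and `y` are nonadjacent.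
[cite: Shewchuk1997, Cor 9 p. 315] -/
theorem twoDiff_nonadjacent (hp : 1 ≤ p) {a b : ℚ} (ha : IsFloat p emin a) (hb : IsFloat p emin b) :
    Nonadjacent (twoDiff (roundTiesEven p emin) a b).2 (twoDiff (roundTiesEven p emin) a b).1 :=
  (twoDiff_below hp (isRoundNearest_roundTiesEven hp) (roundTiesEven_neg (p := p) (emin := emin))
    (roundoffBelow_two_roundTiesEven p emin) ha hb).nonadjacent

/-! ## §2.8: the sign test and the zero test -/

/-- **WHY THE SIGN TEST WORKS.** In a nonoverlapping increasing expansion of floats whose most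
significant component `t` is nonzero, the other components sum to less than `|t|` in magnitude:
writing `t = M·2^v` with `M` odd, every earlier component lies below the lowest nonzero bit of `t`,
i.e. is `< 2^v ≤ |t|` in magnitude, and a nonoverlapping sum of such floats is still `< 2^v`
(`abs_sum_lt_two_zpow_of_isExpansion`). [cite: Shewchuk1997, §2.8 p. 334] -/
theorem abs_sum_lt_abs_of_isExpansion {l : List ℚ} {t : ℚ} (hl : ∀ x ∈ l, IsFloat p emin x)
    (ht : IsFloat p emin t) (ht0 : t ≠ 0) (hexp : IsExpansion 1 (l ++ [t])) : |l.sum| < |t| := by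
  obtain ⟨M, v, hMo, -, -, rfl⟩ := exists_odd_mul_two_zpow ht ht0
  have hpw := List.pairwise_append.mp hexp
  have hlt : ∀ x ∈ l, |x| < (2 : ℚ) ^ v := by
    intro x hx
    obtain ⟨s, hs, hxs⟩ := hpw.2.2 x hx _ (List.mem_singleton_self _)
    rw [one_mul] at hxs
    exact lt_of_lt_of_le hxs (zpow_le_zpow_right₀ (by norm_num) (OnGrid.le_of_odd hMo hs))
  have h1 : |l.sum| < (2 : ℚ) ^ v := abs_sum_lt_two_zpow_of_isExpansion hl hpw.1 hlt
  have hM0 : M ≠ 0 := by rintro rfl; obtain ⟨k, hk⟩ := hMo; omega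
  have hM1 : (1 : ℚ) ≤ |(M : ℚ)| := by
    rw [← Int.cast_abs]; exact_mod_cast Int.one_le_abs hM0
  calc |l.sum| < (2 : ℚ) ^ v := h1
    _ ≤ |(M : ℚ)| * (2 : ℚ) ^ v := le_mul_of_one_le_left (zpow_nonneg (by norm_num) _) hM1
    _ = |(M : ℚ) * (2 : ℚ) ^ v| := by rw [abs_mul, abs_of_pos (zpow_pos (by norm_num : (0:ℚ) < 2) _)]

/-- **THE SIGN TEST**: "simply check the sign of the expansion's most significant nonzero
component" — with `t ≠ 0` the most significant component, the expansion is positive iff `t > 0` and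
negative iff `t < 0`. [cite: Shewchuk1997, §2.8 p. 334] -/
theorem sum_pos_iff_of_isExpansion {l : List ℚ} {t : ℚ} (hl : ∀ x ∈ l, IsFloat p emin x)
    (ht : IsFloat p emin t) (ht0 : t ≠ 0) (hexp : IsExpansion 1 (l ++ [t])) :
    (0 < (l ++ [t]).sum ↔ 0 < t) ∧ ((l ++ [t]).sum < 0 ↔ t < 0) := by
  have h := abs_sum_lt_abs_of_isExpansion hl ht ht0 hexp
  rw [List.sum_append, List.sum_singleton]
  rcases lt_or_gt_of_ne ht0 with hneg | hpos
  · rw [abs_of_neg hneg] at h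
    have := (abs_lt.mp h).2
    exact ⟨⟨fun h' => by linarith, fun h' => by linarith⟩, ⟨fun _ => hneg, fun _ => by linarith⟩⟩
  · rw [abs_of_pos hpos] at h
    have := (abs_lt.mp h).1
    exact ⟨⟨fun _ => hpos, fun _ => by linarith⟩, ⟨fun h' => by linarith, fun h' => by linarith⟩⟩

/-- **THE SIGN TEST WITH ZERO ELIMINATION**: "if zero elimination is employed, check the component
with the largest index" — if the LAST component of a nonoverlapping increasing expansion of floats is
nonzero, the expansion is nonzero and has the sign of that component.
[cite: Shewchuk1997, §2.8 p. 334] -/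
theorem sign_sum_of_getLast_ne_zero {l : List ℚ} (hl : ∀ x ∈ l, IsFloat p emin x)
    (hexp : IsExpansion 1 l) (hne : l ≠ []) (hlast : l.getLast hne ≠ 0) :
    (0 < l.sum ↔ 0 < l.getLast hne) ∧ (l.sum < 0 ↔ l.getLast hne < 0) ∧ l.sum ≠ 0 := by
  have hsplit : l.dropLast ++ [l.getLast hne] = l := List.dropLast_append_getLast hne
  have hl' : ∀ x ∈ l.dropLast, IsFloat p emin x := fun x hx => hl x (List.mem_of_mem_dropLast hx)
  have ht : IsFloat p emin (l.getLast hne) := hl _ (List.getLast_mem hne)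
  have hexp' : IsExpansion 1 (l.dropLast ++ [l.getLast hne]) := by rw [hsplit]; exact hexp
  have h := sum_pos_iff_of_isExpansion hl' ht hlast hexp'
  rw [hsplit] at h
  refine ⟨h.1, h.2, fun h0 => ?_⟩
  rcases lt_or_gt_of_ne hlast with hlt | hgt
  · have := h.2.mpr hlt; rw [h0] at this; exact lt_irrefl _ this
  · have := h.1.mpr hgt; rw [h0] at this; exact lt_irrefl _ this

/-- **THE ZERO TEST**: "A nonoverlapping expansion is equal to zero if and only if all its components
are equal to zero." (Floats, nonoverlapping and increasing except for zeros.)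
[cite: Shewchuk1997, §2.8 p. 334] -/
theorem sum_eq_zero_iff_of_isExpansion {l : List ℚ} (hl : ∀ x ∈ l, IsFloat p emin x)
    (hexp : IsExpansion 1 l) : l.sum = 0 ↔ ∀ x ∈ l, x = 0 := by
  refine ⟨fun h0 => ?_, fun h => List.sum_eq_zero h⟩
  induction l using List.reverseRecOn with
  | nil => simp
  | append_singleton l t ih =>
    have hlF : ∀ x ∈ l, IsFloat p emin x := fun x hx => hl x (List.mem_append_left _ hx)
    have htF : IsFloat p emin t := hl t (by simp)
    have hexp' : IsExpansion 1 l := (List.pairwise_append.mp hexp).1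
    by_cases ht0 : t = 0
    · subst ht0
      have hall := ih hlF hexp' (by simpa using h0)
      intro x hx
      rcases List.mem_append.mp hx with hx | hx
      · exact hall x hx
      · simpa using hx
    · exfalso
      have hlt := abs_sum_lt_abs_of_isExpansion hlF htF ht0 hexp
      rw [List.sum_append, List.sum_singleton] at h0
      rw [show l.sum = -t by linarith, abs_neg] at hlt
      exact lt_irrefl _ hlt

end Literature.ComputerArithmetic.Shewchuk1997
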